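import Literature.MeasureTheory.Group.HaarRightInvariantCompactSubgroup   -- ★ `map_mul_right_eq_self_of_mem_isCompact`, `modularCharacter_eq_one_of_mem_isCompact`
import Literature.NumberTheory.Automorphic.GLnIwasawaIntegration         -- ★ `isInvInvariant_of_isMulRightInvariant` (left + right invariant Haar ⇒ inversion invariant)
import HarnessLib

/-!
# A group exhausted by compact subgroups is unimodular: its left Haar measures are right- and inversion-invariant
# (Folland 1995, §2.4 Prop. 2.27 ∕ Cor. 2.28; organ «UNIMOD-∪K» of the `stub_ShRao` Ranga-Rao existence half, LH4 line, crux H413)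

Topic `MeasureTheory/Group`; namespace `Literature.MeasureTheory.Group`.  THEOREMS ONLY (no definition, no instance, no notation, no named fact, no `sorry`).  Cell
`pub/hodgecm-mathlib`, F0∕P3c line LH4 (`stub_ShRao`, skeleton a42538b5 :111; memo `LH4-SHALIKA-LINE.v1.md` §3 RAO-a∕-b), deal (i) of LH4-plan (g2) 04:08Z to LH3-p02 (g0)
under the desk override 04:05Z; lane `--supports stmt-HodgeConjecture-24833`.  HONEST LABEL: HC_CM is proved only modulo the 7 printed citations (2 remaining: hLiu418 =
stmt-HodgeConjecture-24832, h413 = stmt-HodgeConjecture-24833) until rung 0 closes; this file is generic Haar-measure bookkeeping and pays no printed statement — it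
supplies the `[ρ.IsInvInvariant]` ∕ right-invariance inputs of ★ `InvariantQuotientExistence.quotientMeasure (centralizer {γ}) ρ …` at the unipotent `γ ≠ 1` of
`U(Φ₃)(L⁺_v)`, whose centraliser is exhausted by compact (open) subgroups (organ «CENT-BDD», LH4-p03).

THE MATHEMATICS.  For a locally compact group `H` and a left Haar measure `μ`, right translation by `g` multiplies `μ` by the modular character `Δ(g)` (★
`map_mul_right_eq_modularCharacter_smul`); `Δ` is a continuous homomorphism to `ℝ_{>0}`, so it is trivial on every compact subgroup (★ `modularCharacter_eq_one_of_mem_isCompact`,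
[Folland1995, §2.4 Prop. 2.27]) and `μ` is right-invariant under every element of a compact subgroup (★ `map_mul_right_eq_self_of_mem_isCompact`, [Folland1995, Cor. 2.28]).
If EVERY element of `H` lies in some compact subgroup, `μ` is therefore right-invariant, i.e. `H` is unimodular, and a left- and right-invariant Haar measure on a second
countable locally compact group is inversion invariant (★ `isInvInvariant_of_isMulRightInvariant`: `μ⁻¹ = c μ` by uniqueness, `c² = 1`).  The pointwise hypothesis needs
no directedness of the family of compact subgroups; the case of an exhaustion `H = ⋃ₙ Kₙ` by compact (e.g. compact open) subgroups is the corollary.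
* `isMulRightInvariant_of_forall_mem_isCompact_subgroup`, `isInvInvariant_of_forall_mem_isCompact_subgroup` (pointwise hypothesis);
* `isMulRightInvariant_of_iUnion_isCompact_subgroup`, `isInvInvariant_of_iUnion_isCompact_subgroup` (exhaustion by a sequence of compact subgroups).

## References
* [Folland1995] G. B. Folland, *A Course in Abstract Harmonic Analysis*, CRC Press 1995, §2.4 Prop. 2.27, Cor. 2.28 (the modular function is trivial on compact
  subgroups; groups with that property are unimodular).
* [DeitmarEchterhoff2014] A. Deitmar, S. Echterhoff, *Principles of Harmonic Analysis*, 2nd ed., Thm. 1.5.3 (invariant quotient measures — the consumer).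
-/

set_option autoImplicit false

noncomputable section

open MeasureTheory MeasureTheory.Measure Topology Set

namespace Literature.MeasureTheory.Group

section UnionCompact

variable {H : Type*} [Group H] [TopologicalSpace H] [IsTopologicalGroup H] [LocallyCompactSpace H] [SecondCountableTopology H] [T2Space H]
  [MeasurableSpace H] [BorelSpace H] (μ : Measure H) [μ.IsHaarMeasure]

/-- **A LEFT HAAR MEASURE OF A GROUP IN WHICH EVERY ELEMENT LIES IN A COMPACT SUBGROUP IS RIGHT-INVARIANT** (the group is unimodular): `Δ(g) = 1` for `g` in a
compact subgroup (★ `modularCharacter_eq_one_of_mem_isCompact`), hence `(· g)_* μ = μ` for every `g` (★ `map_mul_right_eq_self_of_mem_isCompact`).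
[cite: Folland1995, §2.4 Prop. 2.27, Cor. 2.28] -/
theorem isMulRightInvariant_of_forall_mem_isCompact_subgroup
    (h : ∀ g : H, ∃ K : Subgroup H, IsCompact (K : Set H) ∧ g ∈ K) : μ.IsMulRightInvariant := by
  refine ⟨fun g => ?_⟩
  obtain ⟨K, hK, hg⟩ := h g
  exact map_mul_right_eq_self_of_mem_isCompact μ K hK hg

/-- **… AND INVERSION-INVARIANT**: a left- and right-invariant Haar measure on a second countable locally compact group satisfies `μ(A⁻¹) = μ(A)`
(★ `isInvInvariant_of_isMulRightInvariant`). [cite: Folland1995, §2.4 Prop. 2.27, Cor. 2.28] -/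
theorem isInvInvariant_of_forall_mem_isCompact_subgroup
    (h : ∀ g : H, ∃ K : Subgroup H, IsCompact (K : Set H) ∧ g ∈ K) : μ.IsInvInvariant := by
  haveI := isMulRightInvariant_of_forall_mem_isCompact_subgroup μ h
  exact Literature.NumberTheory.Automorphic.isInvInvariant_of_isMulRightInvariant μ

/-- The modular character of such a group is trivial. [cite: Folland1995, §2.4 Prop. 2.27] -/
theorem modularCharacter_eq_one_of_forall_mem_isCompact_subgroup
    (h : ∀ g : H, ∃ K : Subgroup H, IsCompact (K : Set H) ∧ g ∈ K) (g : H) : modularCharacter g = 1 := by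
  obtain ⟨K, hK, hg⟩ := h g
  exact modularCharacter_eq_one_of_mem_isCompact K hK hg

/-- **EXHAUSTION BY COMPACT SUBGROUPS ⇒ RIGHT-INVARIANT HAAR**: if `H = ⋃ₙ Kₙ` for a sequence of subgroups `Kₙ` with compact carriers (e.g. an increasing union of
compact open subgroups, as for the centraliser of a unipotent element of `U(Φ₃)(L⁺_v)`), every left Haar measure of `H` is right-invariant (no directedness needed:
the hypothesis is used pointwise). [cite: Folland1995, §2.4 Prop. 2.27, Cor. 2.28] -/
theorem isMulRightInvariant_of_iUnion_isCompact_subgroup (K : ℕ → Subgroup H) (hKc : ∀ n, IsCompact (K n : Set H))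
    (hU : ∀ g : H, ∃ n, g ∈ K n) : μ.IsMulRightInvariant :=
  isMulRightInvariant_of_forall_mem_isCompact_subgroup μ fun g => by
    obtain ⟨n, hn⟩ := hU g
    exact ⟨K n, hKc n, hn⟩

/-- **EXHAUSTION BY COMPACT SUBGROUPS ⇒ INVERSION-INVARIANT HAAR** (same hypothesis). [cite: Folland1995, §2.4 Prop. 2.27, Cor. 2.28] -/
theorem isInvInvariant_of_iUnion_isCompact_subgroup (K : ℕ → Subgroup H) (hKc : ∀ n, IsCompact (K n : Set H))
    (hU : ∀ g : H, ∃ n, g ∈ K n) : μ.IsInvInvariant :=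
  isInvInvariant_of_forall_mem_isCompact_subgroup μ fun g => by
    obtain ⟨n, hn⟩ := hU g
    exact ⟨K n, hKc n, hn⟩

end UnionCompact

end Literature.MeasureTheory.Group

end
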